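import Summits.KontsevichZagierPeriods.KontsevichZagierPeriods.Theorems.RootDecompRationalCubeDichotomyNashMultiGenP11

/-! # `RootDecompRationalCubeDichotomyNashMultiGenP12` — part 12/16 of the mechanical ≤385-line split of `NashEtaleMultiGen.lean`
(split by the decomp-kz census seat for landing; mathematics unchanged; part 12 continues part 11). -/

open Set MvPolynomial Filter Topology
open Literature.NumberTheory.Transcendental (IsSemialgebraicFunOn)
open Literature.ModelTheory.ExponentialFields (IsSemialgebraic isSemialgebraic_setOf_eval_pos
  isSemialgebraic_setOf_eval_ne_zero)

namespace Summit.KontsevichZagierPeriods.RootDecompRationalCubeDichotomy.Rung29430.MultiGen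
open Summit.KontsevichZagierPeriods.KontsevichZagierPeriods.Theses.RootDecompRationalCubeDichotomy
  (NashEtaleCover NashEtaleLocal PiRationalisation)
open Summit.KontsevichZagierPeriods.RootDecompRationalCubeDichotomy.Rung29430.NashEtaleLocalGlue
  (local_of_simple nashEtaleCover_of_nashEtaleLocal nashEtaleLocal_zero)
open Summit.KontsevichZagierPeriods.RootDecompRationalCubeDichotomy.Rung29430.NashEtaleLocalOne
  (analyticOnNhd_aeval_snoc)
open Summit.KontsevichZagierPeriods.RootDecompRationalCubeDichotomy.RungEtale.Etale
  (piRationalisation_of_nashEtaleCover)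

noncomputable section

section SpreadAssembly
open Literature.NumberTheory.Transcendental Literature.ModelTheory.ExponentialFields

/-- **Piece M at all product points of codimension `d` from `SliceNash d`** (permute the
coordinates so that the generic ones come first — a polynomial chart with polynomial inverse —
and transport, §4g). -/
theorem productPointMultiGenCodim_of_sliceNash {n d : ℕ} (hS : SliceNash d) :
    ProductPointMultiGenCodim n d := by
  classical
  intro y₀ hprod g U hU hy₀U hsa han
  obtain ⟨m, e, hmd, he, hind, hzero⟩ := hprod
  subst hmd
  -- enumerate the complement of `range e`
  have hcard : ((Finset.univ.image e)ᶜ : Finset (Fin (m + d))).card = d := by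
    rw [Finset.card_compl, Finset.card_image_of_injective _ he]
    simp
  let c : Fin d → Fin (m + d) := fun j => Finset.orderEmbOfFin _ hcard j
  have hc_mem : ∀ j, c j ∉ Set.range e := by
    rintro j ⟨i, hi⟩
    have : c j ∈ ((Finset.univ.image e)ᶜ : Finset (Fin (m + d))) := Finset.orderEmbOfFin_mem _ hcard j
    rw [Finset.mem_compl] at this
    exact this (Finset.mem_image.mpr ⟨i, Finset.mem_univ _, hi⟩)
  have hc_inj : Function.Injective c := (Finset.orderEmbOfFin _ hcard).injective
  -- the permutation `π = (e, c)`
  let π : Fin (m + d) → Fin (m + d) := Fin.append e c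
  have hπ_inj : Function.Injective π := by
    intro l₁ l₂ h
    induction l₁ using Fin.addCases with
    | left i₁ =>
      induction l₂ using Fin.addCases with
      | left i₂ =>
        simp only [π, Fin.append_left] at h
        rw [he h]
      | right j₂ =>
        simp only [π, Fin.append_left, Fin.append_right] at h
        exact absurd ⟨i₁, h⟩ (hc_mem j₂)
    | right j₁ =>
      induction l₂ using Fin.addCases with
      | left i₂ =>
        simp only [π, Fin.append_left, Fin.append_right] at h
        exact absurd ⟨i₂, h.symm⟩ (hc_mem j₁)
      | right j₂ =>
        simp only [π, Fin.append_right] at h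
        rw [hc_inj h]
  let σ : Fin (m + d) ≃ Fin (m + d) :=
    Equiv.ofBijective π (Finite.injective_iff_bijective.mp hπ_inj)
  have hσ : ∀ l, σ l = π l := fun _ => rfl
  -- the coordinate-permutation chart and its inverse
  let T : Fin (m + d) → MvPolynomial (Fin (m + d)) ℚ := fun l => X (π l)
  have hT : ∀ x, chartMap T x = fun l => x (π l) := fun x => by
    funext l
    simp [chartMap, T]
  have hTy₀ : chartMap T y₀ = Fin.append (fun i => y₀ (e i)) (0 : Fin d → ℝ) := by
    rw [hT]
    funext l
    induction l using Fin.addCases with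
    | left i => simp [π, Fin.append_left]
    | right j =>
      simp only [π, Fin.append_right, Pi.zero_apply]
      exact hzero _ (hc_mem j)
  let ψ : Fin (m + d) → (Fin (m + d) → ℝ) → ℝ := fun j y => y (σ.symm j)
  have hleft : ∀ x ∈ (Set.univ : Set (Fin (m + d) → ℝ)), ∀ j, ψ j (chartMap T x) = x j := by
    intro x _ j
    simp only [ψ, hT]
    rw [← hσ, Equiv.apply_symm_apply]
  -- `G := g ∘ ψ` is `ℚ`-Nash near `Φ_T(y₀) = (y₀ ∘ e, 0)`
  have hlin : ∀ y : Fin (m + d) → ℝ, AnalyticAt ℝ (fun y : Fin (m + d) → ℝ => fun j => ψ j y) y :=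
    fun y => analyticAt_pi_iff.mpr fun j =>
      (ContinuousLinearMap.proj (R := ℝ) (φ := fun _ : Fin (m + d) => ℝ) (σ.symm j)).analyticAt y
  have hcont : Continuous (fun y : Fin (m + d) → ℝ => fun j => ψ j y) :=
    continuous_pi fun j => continuous_apply _
  have hOpre : IsOpen ((fun y : Fin (m + d) → ℝ => fun j => ψ j y) ⁻¹' U) := hU.preimage hcont
  have hy₀pre : chartMap T y₀ ∈ (fun y : Fin (m + d) → ℝ => fun j => ψ j y) ⁻¹' U := by
    rw [Set.mem_preimage]
    have : (fun j => ψ j (chartMap T y₀)) = y₀ := funext fun j => hleft y₀ (Set.mem_univ _) j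
    rw [this]
    exact hy₀U
  obtain ⟨a, b, hyB, hBsub⟩ := exists_ratBox_subset hOpre hy₀pre
  have hGsa : IsSemialgebraicFunOn ℚ (ratBox a b) (fun y => g (fun j => ψ j y)) := by
    have hmap : IsSemialgebraicMapOn ℚ (ratBox a b) (fun y j => ψ j y) :=
      IsSemialgebraicMapOn.of_forall (isSemialgebraic_ratBox a b) fun j =>
        (isSemialgebraicFunOn_aeval (isSemialgebraic_ratBox a b)
          (X (σ.symm j) : MvPolynomial (Fin (m + d)) ℚ)).congr fun y _ => by simp [ψ]
    exact IsSemialgebraicFunOn.comp_isSemialgebraicMapOn_holds hsa hmap (fun y hy => hBsub hy)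
  have hGan : AnalyticOnNhd ℝ (fun y => g (fun j => ψ j y)) (ratBox a b) :=
    fun y hy => (han _ (hBsub hy)).comp (hlin y)
  -- apply the ordered case and transport back
  have hyB' : (Fin.append (fun i => y₀ (e i)) (0 : Fin d → ℝ) : Fin (m + d) → ℝ) ∈ ratBox a b := by
    rw [← hTy₀]
    exact hyB
  obtain ⟨k, hG⟩ := exists_multiGenData_of_sliceNash hS (s₀ := fun i => y₀ (e i))
    hind (isOpen_ratBox a b) hyB' hGsa hGan
  rw [← hTy₀] at hG
  exact ⟨k, multiGenData_transport y₀ T isOpen_univ (Set.mem_univ _) hleft hG⟩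

/-- … in particular from `OriginNash d`. -/
theorem productPointMultiGenCodim_of_originNash {n d : ℕ} (hO : OriginNash d) :
    ProductPointMultiGenCodim n d :=
  productPointMultiGenCodim_of_sliceNash (sliceNash_of_originNash hO)

/-- **Piece M at ALL product points from `SliceNash d`, `1 ≤ d ≤ n`.** -/
theorem productPointMultiGen_of_sliceNash {n : ℕ} (hS : ∀ d, 1 ≤ d → d ≤ n → SliceNash d) :
    ProductPointMultiGen n := by
  classical
  intro y₀ hprod hnot
  obtain ⟨m, e, he, hind, hzero⟩ := hprod
  have hmn : m ≤ n := by simpa using Fintype.card_le_of_injective e he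
  -- `d = n - m ≥ 1`: otherwise `e` is a bijection and `y₀` itself is algebraically independent
  have hd : 1 ≤ n - m := by
    by_contra hd0
    have hmn' : n = m := by omega
    subst hmn'
    apply hnot
    have hbij : Function.Bijective e :=
      (Fintype.bijective_iff_injective_and_card e).mpr ⟨he, by simp⟩
    have hy : y₀ = (y₀ ∘ e) ∘ Function.surjInv hbij.2 := by
      funext j
      simp only [Function.comp_apply, Function.surjInv_eq hbij.2 j]
    rw [hy]
    exact hind.comp _ (Function.injective_surjInv hbij.2)
  exact productPointMultiGenCodim_of_sliceNash (hS (n - m) hd (by omega)) y₀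
    ⟨m, e, by omega, he, hind, hzero⟩

/-- … in particular from `OriginNash d`, `1 ≤ d ≤ n`. -/
theorem productPointMultiGen_of_originNash {n : ℕ} (hO : ∀ d, 1 ≤ d → d ≤ n → OriginNash d) :
    ProductPointMultiGen n :=
  productPointMultiGen_of_sliceNash fun d hd hdn => sliceNash_of_originNash (hO d hd hdn)

/-- **NET (v7).**  `MultiGenAt n`, `NashEtaleLocalAt n`, item 31659, 29430, 24903 from the SLICE
residual `SliceNash d`, `1 ≤ d (≤ n)`. -/
theorem multiGenAt_of_sliceNash {n : ℕ} (hS : ∀ d, 1 ≤ d → d ≤ n → SliceNash d) : MultiGenAt n :=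
  multiGenAt_of_productPointMultiGen (productPointMultiGen_of_sliceNash hS)

/-- Auxiliary step `nashEtaleLocalAt_of_sliceNash`. [bookkeeping] -/
theorem nashEtaleLocalAt_of_sliceNash {n : ℕ} (hS : ∀ d, 1 ≤ d → d ≤ n → SliceNash d) :
    NashEtaleLocalAt n :=
  nashEtaleLocalAt_iff_multiGenAt.mpr (multiGenAt_of_sliceNash hS)

/-- Auxiliary step `nashEtaleLocal_of_sliceNash`. [bookkeeping] -/
theorem nashEtaleLocal_of_sliceNash (hS : ∀ d, 1 ≤ d → SliceNash d) : NashEtaleLocal :=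
  nashEtaleLocal_iff.mpr fun _ => nashEtaleLocalAt_of_sliceNash fun d hd _ => hS d hd

/-- Auxiliary step `nashEtaleCover_of_sliceNash`. [bookkeeping] -/
theorem nashEtaleCover_of_sliceNash (hS : ∀ d, 1 ≤ d → SliceNash d) : NashEtaleCover :=
  nashEtaleCover_of_nashEtaleLocal (nashEtaleLocal_of_sliceNash hS)

/-- Auxiliary step `piRationalisation_of_sliceNash`. [bookkeeping] -/
theorem piRationalisation_of_sliceNash (hS : ∀ d, 1 ≤ d → SliceNash d) : PiRationalisation :=
  piRationalisation_of_nashEtaleCover (nashEtaleCover_of_sliceNash hS)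

/-- **NET (v5).**  `MultiGenAt n`, `NashEtaleLocalAt n` from `OriginNash d`, `1 ≤ d ≤ n`. -/
theorem multiGenAt_of_originNash {n : ℕ} (hO : ∀ d, 1 ≤ d → d ≤ n → OriginNash d) : MultiGenAt n :=
  multiGenAt_of_productPointMultiGen (productPointMultiGen_of_originNash hO)

/-- Auxiliary step `nashEtaleLocalAt_of_originNash`. [bookkeeping] -/
theorem nashEtaleLocalAt_of_originNash {n : ℕ} (hO : ∀ d, 1 ≤ d → d ≤ n → OriginNash d) :
    NashEtaleLocalAt n :=
  nashEtaleLocalAt_iff_multiGenAt.mpr (multiGenAt_of_originNash hO)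

/-- **Item 31659 `NashEtaleLocal` from the parameter-free residual** `∀ d ≥ 1, OriginNash d`. -/
theorem nashEtaleLocal_of_originNash (hO : ∀ d, 1 ≤ d → OriginNash d) : NashEtaleLocal :=
  nashEtaleLocal_iff.mpr fun _ => nashEtaleLocalAt_of_originNash fun d hd _ => hO d hd

/-- … hence item 29430 `NashEtaleCover` … -/
theorem nashEtaleCover_of_originNash (hO : ∀ d, 1 ≤ d → OriginNash d) : NashEtaleCover :=
  nashEtaleCover_of_nashEtaleLocal (nashEtaleLocal_of_originNash hO)

/-- … and the crux 24903 `PiRationalisation`. -/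
theorem piRationalisation_of_originNash (hO : ∀ d, 1 ≤ d → OriginNash d) : PiRationalisation :=
  piRationalisation_of_nashEtaleCover (nashEtaleCover_of_originNash hO)

/-! ### §6.5  The DEFECT-1 stratum in EVERY dimension needs only `OriginNash 1` (PROVED) -/

/-- The chart of §4d at a point for a PRESCRIBED maximal algebraically independent set of
coordinates `e`. -/
theorem exists_chart_of_maximal {n m : ℕ} (x₀ : Fin n → ℝ) (e : Fin m → Fin n)
    (he : Function.Injective e) (hind : AlgebraicIndependent ℚ (x₀ ∘ e))
    (hmax : ∀ j ∉ Set.range e,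
      ¬ AlgebraicIndependent ℚ (Fin.snoc (x₀ ∘ e) (x₀ j) : Fin (m + 1) → ℝ)) :
    ∃ T : Fin n → MvPolynomial (Fin n) ℚ, (∀ i, T (e i) = X (e i)) ∧
      ∀ j ∉ Set.range e,
        MvPolynomial.aeval x₀ (T j) = 0 ∧ MvPolynomial.aeval x₀ (pderiv j (T j)) ≠ 0 ∧
        ∀ l ∉ Set.range e, l ≠ j → pderiv l (T j) = 0 := by
  classical
  have hT : ∀ j : Fin n, ∃ Tj : MvPolynomial (Fin n) ℚ, j ∉ Set.range e →
      MvPolynomial.aeval x₀ Tj = 0 ∧ MvPolynomial.aeval x₀ (pderiv j Tj) ≠ 0 ∧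
      ∀ l ∉ Set.range e, l ≠ j → pderiv l Tj = 0 := by
    intro j
    by_cases hj : j ∈ Set.range e
    · exact ⟨0, fun h => (h hj).elim⟩
    obtain ⟨T', hT'0, hT'1⟩ := exists_transversal_poly hind (hmax j hj)
    have hemb := extendEmb_injective he hj
    refine ⟨MvPolynomial.rename (extendEmb e j) T', fun _ => ⟨?_, ?_, fun l hl hlj => ?_⟩⟩
    · rw [MvPolynomial.aeval_rename, comp_extendEmb, hT'0]
    · have key : pderiv j (MvPolynomial.rename (extendEmb e j) T') =
          MvPolynomial.rename (extendEmb e j) (pderiv (Fin.last m) T') := by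
        have := MvPolynomial.pderiv_rename hemb (Fin.last m) T'
        rwa [extendEmb_last] at this
      rw [key, MvPolynomial.aeval_rename, comp_extendEmb]
      exact hT'1
    · exact pderiv_rename_eq_zero _ l (extendEmb_ne e j hl hlj) T'
  choose Tf hTf using hT
  refine ⟨fun i => if i ∈ Set.range e then X i else Tf i, fun i => ?_, fun j hj => ?_⟩
  · simp
  · simp only [hj, if_false]
    exact hTf j hj

/-- **At a point of defect exactly `1`, piece M (germ form) follows from the codimension-`1`
product points** — hence from `OriginNash 1`: the coordinates `≠ i` are a maximal algebraically
independent set, the chart has `m = n − 1`, `d = 1`. -/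
theorem nashGermMultiGen_of_defectOne {n : ℕ} (h : ProductPointMultiGenCodim n 1) (x₀ : Fin n → ℝ)
    (hnot : ¬ AlgebraicIndependent ℚ x₀) (h1 : DefectLeOne x₀) : NashGermMultiGen n x₀ := by
  classical
  obtain ⟨i, hi⟩ := h1
  obtain ⟨n', rfl⟩ : ∃ n', n = n' + 1 := ⟨n - 1, by have := Fin.pos i; omega⟩
  intro g U hU hx₀U hsa han
  -- the coordinates `≠ i` form a maximal algebraically independent set
  have heq : (x₀ ∘ i.succAbove) =
      (fun j : {j : Fin (n' + 1) // j ≠ i} => x₀ (j : Fin (n' + 1))) ∘ (finSuccAboveEquiv i) := by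
    funext l
    simp [finSuccAboveEquiv_apply]
  have hind : AlgebraicIndependent ℚ (x₀ ∘ i.succAbove) := by
    rw [heq]
    exact hi.comp _ (finSuccAboveEquiv i).injective
  have he : Function.Injective i.succAbove := Fin.succAbove_right_injective
  have hmax : ∀ j ∉ Set.range i.succAbove,
      ¬ AlgebraicIndependent ℚ (Fin.snoc (x₀ ∘ i.succAbove) (x₀ j) : Fin (n' + 1) → ℝ) := by
    intro j hj hs
    have hji : j = i := by
      rw [Fin.range_succAbove] at hj
      simpa using hj
    subst hji
    apply hnot
    -- reindex: `x₀ = snoc (x₀ ∘ succAbove j) (x₀ j) ∘ ρ`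
    let ρ : Fin (n' + 1) → Fin (n' + 1) := fun l =>
      if hl : l = j then Fin.last n' else Fin.castSucc ((finSuccAboveEquiv j).symm ⟨l, hl⟩)
    have hsymm : ∀ x : {l : Fin (n' + 1) // l ≠ j},
        j.succAbove ((finSuccAboveEquiv j).symm x) = (x : Fin (n' + 1)) := by
      intro x
      have := (finSuccAboveEquiv j).apply_symm_apply x
      rw [finSuccAboveEquiv_apply] at this
      exact congrArg Subtype.val this
    have hρ : (Fin.snoc (x₀ ∘ j.succAbove) (x₀ j) : Fin (n' + 1) → ℝ) ∘ ρ = x₀ := by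
      funext l
      by_cases hl : l = j
      · subst hl
        simp [ρ]
      · simp only [Function.comp_apply, ρ, hl, dif_neg, not_false_eq_true, Fin.snoc_castSucc]
        exact congrArg x₀ (hsymm ⟨l, hl⟩)
    have hρinj : Function.Injective ρ := by
      intro l₁ l₂ hl
      by_cases h₁ : l₁ = j <;> by_cases h₂ : l₂ = j
      · rw [h₁, h₂]
      · simp only [ρ, h₁, h₂, dif_pos, dif_neg, not_false_eq_true] at hl
        exact absurd hl.symm (Fin.castSucc_lt_last _).ne
      · simp only [ρ, h₁, h₂, dif_pos, dif_neg, not_false_eq_true] at hl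
        exact absurd hl (Fin.castSucc_lt_last _).ne
      · simp only [ρ, h₁, h₂, dif_neg, not_false_eq_true] at hl
        have := (finSuccAboveEquiv j).symm.injective (Fin.castSucc_injective _ hl)
        exact congrArg Subtype.val this
    rw [← hρ]
    exact hs.comp ρ hρinj
  obtain ⟨T, hTe, hT⟩ := exists_chart_of_maximal x₀ i.succAbove he hind hmax
  -- the transport argument of §4g with this chart
  have hdet := det_chart_ne_zero x₀ i.succAbove T hTe (fun j hj => ⟨(hT j hj).2.1, (hT j hj).2.2⟩)
  obtain ⟨V, ψ, hVo, hy₀V, hψ₀, hψsa, hψan, hψ⟩ := exists_chart_inverse x₀ T hdet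
  obtain ⟨W, hWo, hx₀W, -, hleft⟩ := chart_leftInverse_near x₀ T hdet hVo hy₀V hψ₀ hψan hψ
  have hψv_cont : ContinuousOn (fun y j => ψ j y) V :=
    continuousOn_pi.2 fun j => (hψan j).continuousOn
  have hψv₀ : (fun j => ψ j (chartMap T x₀)) = x₀ := funext hψ₀
  have hO : IsOpen (V ∩ (fun y j => ψ j y) ⁻¹' U) := hψv_cont.isOpen_inter_preimage hVo hU
  obtain ⟨a, b, hy₀B, hBsub⟩ := exists_ratBox_subset hO
    ⟨hy₀V, show (fun j => ψ j (chartMap T x₀)) ∈ U by rw [hψv₀]; exact hx₀U⟩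
  have hGsa : IsSemialgebraicFunOn ℚ (ratBox a b) (fun y => g (fun j => ψ j y)) := by
    have hmap : IsSemialgebraicMapOn ℚ (ratBox a b) (fun y j => ψ j y) :=
      IsSemialgebraicMapOn.of_forall (isSemialgebraic_ratBox a b) fun j =>
        (hψsa j).mono (fun y hy => (hBsub hy).1) (isSemialgebraic_ratBox a b)
    exact IsSemialgebraicFunOn.comp_isSemialgebraicMapOn_holds hsa hmap
      (fun y hy => (hBsub hy).2)
  have hGan : AnalyticOnNhd ℝ (fun y => g (fun j => ψ j y)) (ratBox a b) := by
    intro y hy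
    have hψvan : AnalyticAt ℝ (fun y j => ψ j y) y := AnalyticAt.pi fun j => hψan j y (hBsub hy).1
    exact (han _ (hBsub hy).2).comp hψvan
  have hce : chartMap T x₀ ∘ i.succAbove = x₀ ∘ i.succAbove := by
    funext l
    simp [Function.comp, chartMap, hTe]
  have hprod : ∃ (m : ℕ) (e : Fin m → Fin (n' + 1)), m + 1 = n' + 1 ∧ Function.Injective e ∧
      AlgebraicIndependent ℚ (chartMap T x₀ ∘ e) ∧ ∀ j ∉ Set.range e, chartMap T x₀ j = 0 :=
    ⟨n', i.succAbove, rfl, he, by rw [hce]; exact hind, fun j hj => (hT j hj).1⟩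
  obtain ⟨k, hG⟩ := h (chartMap T x₀) hprod
    (fun y => g (fun j => ψ j y)) (ratBox a b) (isOpen_ratBox a b) hy₀B hGsa hGan
  exact ⟨k, multiGenData_transport x₀ T hWo hx₀W hleft hG⟩

/-- **The defect-1 stratum in every dimension from `OriginNash 1`** (point-data dress; the
critic's preferred defect-1 support is thereby ONE parameter-free statement about one-variable
`K`-Nash germs, for which g7's `nashEtaleLocalAt_one` is the template). -/
theorem pointDataDefectOneAt_of_sliceNash_one {n : ℕ} (hS : SliceNash 1) :
    PointDataDefectOneAt n := by
  intro g U hU hKU hsa han x₀ hx₀ hnot h1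
  obtain ⟨k, hM⟩ := nashGermMultiGen_of_defectOne (productPointMultiGenCodim_of_sliceNash hS)
    x₀ hnot h1 g U hU (hKU hx₀) hsa han
  exact pointDataAt_of_multiGenData hM

/-- Auxiliary step `multiGenDefectOneAt_of_sliceNash_one`. [bookkeeping] -/
theorem multiGenDefectOneAt_of_sliceNash_one {n : ℕ} (hS : SliceNash 1) : MultiGenDefectOneAt n :=
  pointDataDefectOneAt_iff.mp (pointDataDefectOneAt_of_sliceNash_one hS)

/-- Auxiliary step `pointDataDefectOneAt_of_originNash_one`. [bookkeeping] -/
theorem pointDataDefectOneAt_of_originNash_one {n : ℕ} (hO : OriginNash 1) :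
    PointDataDefectOneAt n :=
  pointDataDefectOneAt_of_sliceNash_one (sliceNash_of_originNash hO)

/-- Auxiliary step `multiGenDefectOneAt_of_originNash_one`. [bookkeeping] -/
theorem multiGenDefectOneAt_of_originNash_one {n : ℕ} (hO : OriginNash 1) : MultiGenDefectOneAt n :=
  pointDataDefectOneAt_iff.mp (pointDataDefectOneAt_of_originNash_one hO)

/-- **NET for the critic's two-support split:** item 31659 from `OriginNash 1` (defect-1 points,
every dimension) and point data at the points of defect `≥ 2`. -/
theorem nashEtaleLocal_of_originNash_one (hO : OriginNash 1)
    (h₂ : ∀ n, 2 ≤ n → PointDataDefectTwoAt n) : NashEtaleLocal :=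
  nashEtaleLocal_of_pointDataStrata (fun _ _ => pointDataDefectOneAt_of_originNash_one hO) h₂

/-- In particular the `n = 2` slice of item 31659 (the unit SQUARE) needs `OriginNash 1` and point
data at the points of the square with BOTH coordinates algebraic (`not_defectLeOne_two_iff`). -/
theorem nashEtaleLocalAt_two_of_originNash_one (hO : OriginNash 1) (h₂ : PointDataDefectTwoAt 2) :
    NashEtaleLocalAt 2 :=
  nashEtaleLocalAt_iff_multiGenAt.mpr
    (multiGenAt_of_strata (multiGenDefectOneAt_of_originNash_one hO) (pointDataDefectTwoAt_iff.mp h₂))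

end SpreadAssembly

/-! ### §6.6  Tools for the residual: analytic implicit functions and local uniqueness for
`K`-polynomial étale systems (the analytic half of §4e with an ARBITRARY coefficient ring
`K → ℝ`; no semialgebraicity) -/

namespace NashImplicitK

open Literature.NumberTheory.Transcendental Literature.ModelTheory.ExponentialFields

variable {K : Type} [CommRing K] [Algebra K ℝ]

/-! ## §1  Strict derivative of a polynomial map -/

/-- The derivative of `z ↦ p(z)` at `z₀`, as the continuous linear form
`v ↦ ∑ⱼ ∂ⱼp(z₀) vⱼ`. -/
def D {N : ℕ} (p : MvPolynomial (Fin N) K) (z₀ : Fin N → ℝ) : (Fin N → ℝ) →L[ℝ] ℝ :=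
  ∑ j : Fin N, (MvPolynomial.aeval z₀ (pderiv j p)) • ContinuousLinearMap.proj j

/-- Auxiliary step `D_apply`. [bookkeeping] -/
theorem D_apply {N : ℕ} (p : MvPolynomial (Fin N) K) (z₀ v : Fin N → ℝ) :
    D p z₀ v = ∑ j : Fin N, MvPolynomial.aeval z₀ (pderiv j p) * v j := by
  simp [D]

end NashImplicitK
end
end Summit.KontsevichZagierPeriods.RootDecompRationalCubeDichotomy.Rung29430.MultiGen
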